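import Literature.MathematicalPhysics.QuantumFieldTheory.Balaban1983to89.B9Thm311ProjectionR
import Literature.MathematicalPhysics.QuantumFieldTheory.Balaban1983to89.T4PlaqDisjointFamilies

/-!
# `Balaban1983to89.B9Thm311DeltaAFrustratedWitness` — THE NEGATIVE SIDE OF ROW 17's ONE DISPLAYED CLAUSE: without the regularity class (3.35),
# Theorem 3.11's «Δ_a(U) positive definite» FAILS — at the maximally frustrated ℤ₂ background (every plaquette variable `U(∂p) = −1`) def-Y's
# `Δ_a(U) = Δ(U) + D_U R(U) D\*_U + Q\*(U) a Q(U)` is NOT positive definite, at EVERY k-level index and for EVERY choice of its letters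

T. Bałaban, *Propagators for lattice gauge theories in a background field*, Commun. Math. Phys. **99** (1985) 389–434
[`Balaban1985BackgroundPropagators`, "B9"]; [4] = *Propagators … II* [`Balaban1984PropagatorsII`].

statement-level skeleton of published theorems with citation tags; proofs where landed; nothing here is a claim about the
Yang–Mills mass gap

THE PRINTED LOCI (verbatim).  p. 416, Theorem 3.11: *"Let us assume that U satisfies the condition (3.35). Then the operators Δ′_a, G′, (Q′G′²Q′\*)⁻¹,
Δ_a, G are positive definite"*;  (3.26) p. 395: *"Δ_a = Δ + DRD\* + Q\*aQ"*;  (3.10) p. 392: `Δ = D\*D + Δ′`, `⟨A, Δ′A⟩ = Σ_p η^d tr((D_UA)(p))²η⁻²(Re U(∂p) − 1)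
+ tr Σ i[A′(b₁), A′(b₂)]η⁻² Im U(∂p)`;  (3.35) p. 396: on every cube `U^u = e^{iηA}` with `|A|, |∇^ηA|` small.

WHY THIS FILE.  After gens 6–7 of this seat, row 17 (`t311`) of the N06 knit at def-Y's letters of record displays exactly ONE clause (n06-d's binder
`hΔA`): `PosDefTr 1 (deltaAY _ (parSymY _) (parBY _) (GpY _ (parSymY _)) U)` for `U` in the class (3.35) — every other ingredient of Theorem 3.11 there is a
theorem (`B9Thm311PosAtRecordV4.t311_of_pins_opsYOfLettersV4₁`), and gen 7 located the clause on the Hessian `Δ(U)` of the Wilson action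
(`B9Thm311ProjectionR.trIP_deltaAY_parSymY_eq`: the two other terms of (3.26) are squares).  Its sibling `pos0` («Δ′_a(U) > 0») turned out to be ALGEBRAIC —
true for every unitary-valued `U` (`B9Thm311DeltaPrimePos`).  THIS FILE shows `hΔA` is NOT: it is false outside (3.35), so the regularity class is
load-bearing in the certificate and the clause must stay displayed until Theorems 3.3∕3.10 (GAPS G-B9-06) are proved.  (The `…_false_without_(3.35)`
companion of the configuration witness `B9Thm311DeltaPrimeWitness` of gen 6.)

THE MECHANISM (print (3.10), (3.26); elementary).  NODE 00's tori have an EVEN number `2L^{m+K−j}` of sites per direction (`Setup.Params.sitesPerDir`), so the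
parity signs `(−1)^{x_κ}` are well defined on them and the ℤ₂ «staircase» background `U_ν(x) := Π_{κ<ν}(−1)^{x_κ}·1` has `U(∂p) = −1` on EVERY plaquette
(§1–§2: the Wilson action at its global maximum).  There `Re U(∂p) = −1`, `Im U(∂p) = 0`: the commutator part `Δ′₂(U)` of def-Y's Hessian vanishes and its
Jordan insertion is `−id`, so `Δ(U) = −D\*_U∘D_U` (curl sector) and `⟨A, Δ(U)A⟩₁ = −‖D_UA‖² ≤ 0` for ALL bond functions `A` (§3, by this seat's (3.9)
adjointness `isAdjTr_curlY_coCurlY`; the background is `±1`-valued, hence unitary).  On `ker D\*_U ∩ ker Q(U)` the gauge-fixing and averaging terms of (3.26)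
vanish LETTER BY LETTER (`deltaAY_apply_of_divY_QY_eq_zero` — any transport contours `parS`, `parB`, any site-propagator letter `Gp`), so there
`⟨A, Δ_a(U)A⟩₁ ≤ 0`; and that joint kernel is non-zero by rank–nullity (§4–§5): `|sites| + |𝔅| < |bonds| = (d+1)|sites|`, because p21's families put NO index
bond at level 0 (`TDomains.one_le_lev`, so `Ω₁ = T_η` in `domT` and `Λ₀ = ∅`), whence `|𝔅| ≤ (d+1)|T_η|·Σ_{j≥1}L^{−(d+1)j} ≤ (d+1)|T_η|∕24` (`L ≥ 5`).

WHAT IS PROVED (sorry-free).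
* §1 (any `Setup` torus) `sgn2`, `parSgn` (parity sign on `ℤ/2L^{m+K−j}` via `ZMod.castHom`), `stairSgn`, `stairSgn_shift`, ★ `stairSgn_plaquette` (the four signs
  around every plaquette multiply to `−1`), ★ `frustCfgV` (the background as a `CfgV1`, values `Units.map (Int.castRingHom 𝔸) (±1)`), `frustCfgV_val_eq_or`.
* §2 (k-level index `i`) `frustCfg`, ★ `holY_frustCfg` ∕ `val_holY_frustCfg` ∕ `val_inv_holY_frustCfg` (`U(∂p) = U(∂p)⁻¹ = −1`), `frustCfg_eq_one_or`,
  `frustCfg_mem_of_neg_one_mem`, `reHolY_frustCfg` (`= −1`), `imHolY_frustCfg` (`= 0`), ★ `jordanY_frustCfg` (`= −id`), ★ `curv2Y_frustCfg` (`= 0`),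
  ★★ `hessY_frustCfg` (`Δ(U) = −(coCurl ∘ curl)`).
* §3 `trIP_neg_right`, `frustCfg_mem_unitary`, ★★ `trIP_hessY_frustCfg` (`⟨A, Δ(U)A⟩₁ = −⟨D_UA, D_UA⟩₁`), `trIP_hessY_frustCfg_nonpos`,
  ★ `deltaAY_apply_of_divY_QY_eq_zero` (generic: `Δ_a(U)A = Δ(U)A` on `ker D\* ∩ ker Q`), `trIP_deltaAY_frustCfg_nonpos`, ★★ `not_posDefTr_deltaAY_frustCfg_of`.
* §4 `card_site_mul_pow`, `card_FBondY`, `card_SiteY`, ★ `not_lamBond_zero` (no level-0 index bond), `sigmaSubtypeEquiv`, `card_IBondY_eq_sum`,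
  `twentyfive_le_pow`, ★★ `card_IBondY_le` (`|𝔅| ≤ (d+1)|T_η|∕24`), ★★ `card_SiteY_add_card_IBondY_lt` (`|sites| + |𝔅| < |bonds|`).
* §5 `neg_one_mem_specialUnitaryUnits` (`−1 ∈ SU(N)`, `N` even), `frustCfg_mem_specialUnitaryUnits`, ★ `exists_ne_zero_divY_QY_eq_zero` (rank–nullity,
  `LinearMap.ker_ne_bot_of_finrank_lt`), ★★★ `not_posDefTr_deltaAY_frustCfg` (every index of dimension `d + 1 ≥ 2`, every `N ≥ 1`, EVERY `parS parB Gp`),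
  ★★★ `exists_not_posDefTr_deltaAY`, ★★★ `not_forall_posDefTr_deltaAY_parSymY` (the (3.35)-free version of the knit's binder `hΔA` is FALSE at every index),
  `exists_not_posDefTr_deltaAY_parSymY`.

HONEST SCOPE.  A NEGATIVE-SIDE witness OUTSIDE the regularity class (3.35) (`‖U(∂p) − 1‖ = 2` on every plaquette); finite-dimensional algebra over landed
letters plus a census count; nothing of [B9] is asserted, no estimate of the paper is proved; it documents that the displayed clause of row 17 is not a
tautology of the letters (unlike `pos0`), nothing more.  NOT a node discharge, NOT summit progress; count-neutral; nothing continuum, nothing about the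
mass gap.  Cell `pub-ymgap` (HUMAN RULING D-0062), Track A node N06 [B9], seat `pub-ymgap-dag-n06-j` (harness re-seat gen 10), 2026-08-27.
-/

namespace Literature.MathematicalPhysics.QuantumFieldTheory.Balaban1983to89.B9Thm311DeltaAFrustratedWitness

open Literature.MathematicalPhysics.QuantumFieldTheory.Balaban1983to89
open B9Thm311ReadingCoords B9Thm311AdjointPairs B9Thm311DeltaPrimeSymm B9Thm311DeltaPrimePos Node00
open B6KLevelCensusIndexV1 B9BackgroundsKLevelV1 B6GlobalChartV1
open scoped Matrix

noncomputable section

/-! ## §1 The ℤ₂ staircase background of an even torus: every plaquette variable is `−1` -/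

section Torus

variable {P : Params} {j : ℕ}

/-- the sign character of `ℤ/2`: `0 ↦ 1`, `1 ↦ −1` (values in `ℤˣ`). [cite: Balaban1985BackgroundPropagators, (3.1) p.390, dictionary] -/
def sgn2 (z : ZMod 2) : ℤˣ := if z = 0 then 1 else -1

/-- the sign character alternates: `sgn2 (z + 1) = −sgn2 z`. [cite: Balaban1985BackgroundPropagators, (3.1) p.390, bookkeeping] -/
theorem sgn2_add_one (z : ZMod 2) : sgn2 (z + 1) = -sgn2 z := by
  fin_cases z <;> decide

/-- the parity sign `(−1)^t` of a torus coordinate `t ∈ ℤ/(2L^{m+K−j})`, well defined because every torus of `Setup` has an EVEN number of sites per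
direction (`T4PlaqDisjointFamilies.two_dvd_sitesPerDir`). [cite: Balaban1985BackgroundPropagators, (3.1) p.390, dictionary] -/
def parSgn (P : Params) (j : ℕ) (t : ZMod (P.sitesPerDir j)) : ℤˣ := sgn2 (ZMod.castHom (T4PlaqDisjointFamilies.two_dvd_sitesPerDir P j) (ZMod 2) t)

/-- one lattice step flips the parity sign (also across the periodic wrap). [cite: Balaban1985BackgroundPropagators, (3.1) p.390, bookkeeping] -/
theorem parSgn_add_one (t : ZMod (P.sitesPerDir j)) : parSgn P j (t + 1) = -parSgn P j t := by
  unfold parSgn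
  rw [map_add, map_one, sgn2_add_one]

/-- the STAIRCASE SIGN of a bond direction `ν` at a site `x`: `Π_{κ<ν} (−1)^{x_κ}`. [cite: Balaban1985BackgroundPropagators, (3.1) p.390, dictionary] -/
def stairSgn (ν : Fin P.d) (x : Site P j) : ℤˣ := ∏ κ ∈ Finset.univ.filter (· < ν), parSgn P j (x κ)

/-- a step in direction `μ` flips the staircase sign of direction `ν` iff `μ < ν`. [cite: Balaban1985BackgroundPropagators, (3.1) p.390, bookkeeping] -/
theorem stairSgn_shift (ν μ : Fin P.d) (x : Site P j) : stairSgn ν (x.shift μ) = stairSgn ν x * (if μ < ν then -1 else 1) := by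
  unfold stairSgn
  have h : ∀ κ ∈ Finset.univ.filter (· < ν), parSgn P j ((x.shift μ) κ) = parSgn P j (x κ) * (if κ = μ then -1 else 1) := by
    intro κ _
    unfold Site.shift
    by_cases hκ : κ = μ
    · subst hκ
      rw [Function.update_self, parSgn_add_one, if_pos rfl, mul_neg_one]
    · rw [Function.update_of_ne hκ, if_neg hκ, mul_one]
  rw [Finset.prod_congr rfl h, Finset.prod_mul_distrib, Finset.prod_ite_eq' (Finset.univ.filter (· < ν)) μ (fun _ => (-1 : ℤˣ))]
  simp only [Finset.mem_filter, Finset.mem_univ, true_and]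

/-- ★ **EVERY PLAQUETTE OF THE STAIRCASE BACKGROUND IS FRUSTRATED**: on `p = ⟨x, x+e_μ, x+e_μ+e_ν, x+e_ν⟩`, `μ < ν`, the product of the
four staircase signs around `∂p` is `−1`. [cite: Balaban1985BackgroundPropagators, (3.1) p.390 (U(∂p)), (3.7) p.391] -/
theorem stairSgn_plaquette (p : Plaq P j) :
    stairSgn p.μ p.src * stairSgn p.ν (p.src.shift p.μ) * (stairSgn p.μ (p.src.shift p.ν))⁻¹ * (stairSgn p.ν p.src)⁻¹ = -1 := by
  rw [stairSgn_shift, stairSgn_shift, if_pos p.hμν, if_neg (not_lt.mpr p.hμν.le), mul_one, Int.units_inv_eq_self,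
    Int.units_inv_eq_self]
  set a := stairSgn p.μ p.src
  set b := stairSgn p.ν p.src
  calc a * (b * -1) * a * b = a * a * (b * b) * -1 := by ac_rfl
    _ = -1 := by rw [Int.units_mul_self, Int.units_mul_self, one_mul, one_mul]

variable (P) (𝔸 : Type) [Ring 𝔸]

/-- ★ **THE MAXIMALLY FRUSTRATED ℤ₂ BACKGROUND** `U_ν(x) = Π_{κ<ν}(−1)^{x_κ} · 1 ∈ 𝔸ˣ` (values `±1`, central).
[cite: Balaban1985BackgroundPropagators, (3.1) p.390, (3.35) p.396 (a configuration OUTSIDE the regularity class), dictionary] -/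
def frustCfgV : CfgV1 P 𝔸 := fun ν x => Units.map (Int.castRingHom 𝔸 : ℤ →* 𝔸) (stairSgn ν x)

variable {P 𝔸}

/-- the background's values are `±1`. [cite: Balaban1985BackgroundPropagators, (3.1) p.390, bookkeeping] -/
theorem frustCfgV_val_eq_or (ν : Fin P.d) (x : Site P 0) :
    ((frustCfgV P 𝔸 ν x : 𝔸ˣ) : 𝔸) = 1 ∨ ((frustCfgV P 𝔸 ν x : 𝔸ˣ) : 𝔸) = -1 := by
  unfold frustCfgV
  rcases Int.units_eq_one_or (stairSgn ν x) with h | h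
  · left; rw [h, map_one, Units.val_one]
  · right; rw [h, Units.coe_map, Units.val_neg, Units.val_one]; simp

end Torus

/-! ## §2 At a k-level index: `U(∂p) = −1`, `Re U(∂p) = −1`, `Im U(∂p) = 0`, `𝒦_U = −id`, `Δ′₂(U) = 0`, `Δ(U) = −D\* D` -/

section Index

variable {d ℓ : ℕ} {hd : 1 ≤ d + 1} {hL : Odd (ℓ + 1) ∧ 1 < ℓ + 1} {b₀ b₁ : ℝ}
variable (𝔸 : Type) [NormedRing 𝔸] [NormedAlgebra ℂ 𝔸] [CompleteSpace 𝔸]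
variable (i : KIdx d ℓ hd hL b₀ b₁)

/-- the maximally frustrated ℤ₂ background at a k-level index (NODE 00's carriers). [cite: Balaban1985BackgroundPropagators, (3.1) p.390, (3.35) p.396, dictionary] -/
def frustCfg : CfgY 𝔸 i := frustCfgV (PV d ℓ i.m i.K hd hL) 𝔸

variable {𝔸}

/-- ★ **`U(∂p) = −1` ON EVERY PLAQUETTE** of the frustrated background. [cite: Balaban1985BackgroundPropagators, (3.1) p.390, (3.7) p.391] -/
theorem holY_frustCfg (p : PlaqY i) : holY i (frustCfg 𝔸 i) p = Units.map (Int.castRingHom 𝔸 : ℤ →* 𝔸) (-1) := by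
  unfold holY frustCfg frustCfgV
  rw [← map_inv, ← map_inv, ← map_mul, ← map_mul, ← map_mul, stairSgn_plaquette]

/-- `U(∂p) = −1` as an element of `𝔸`. [cite: Balaban1985BackgroundPropagators, (3.1) p.390, bookkeeping] -/
theorem val_holY_frustCfg (p : PlaqY i) : ((holY i (frustCfg 𝔸 i) p : 𝔸ˣ) : 𝔸) = -1 := by
  rw [holY_frustCfg, Units.coe_map, Units.val_neg, Units.val_one]
  simp

/-- `U(∂p)⁻¹ = −1` as an element of `𝔸`. [cite: Balaban1985BackgroundPropagators, (3.5) p.391, bookkeeping] -/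
theorem val_inv_holY_frustCfg (p : PlaqY i) : (((holY i (frustCfg 𝔸 i) p)⁻¹ : 𝔸ˣ) : 𝔸) = -1 := by
  rw [holY_frustCfg, ← map_inv, Int.units_inv_eq_self, Units.coe_map, Units.val_neg, Units.val_one]
  simp

/-- the background's values are the units `1` or `−1`. [cite: Balaban1985BackgroundPropagators, (3.1) p.390, bookkeeping] -/
theorem frustCfg_eq_one_or (μ : Fin (d + 1)) (x : Site (PV d ℓ i.m i.K hd hL) 0) : frustCfg 𝔸 i μ x = 1 ∨ frustCfg 𝔸 i μ x = -1 := by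
  unfold frustCfg frustCfgV
  rcases Int.units_eq_one_or (stairSgn μ x) with h | h
  · left; rw [h, map_one]
  · right; rw [h]; ext; rw [Units.coe_map, Units.val_neg, Units.val_one, Units.val_neg, Units.val_one]; simp

/-- hence the background is `G`-valued for every structure group containing `−1` (e.g. `U(N)`; `SU(N)` for even `N`, in particular `SU(2)`).
[cite: Balaban1985BackgroundPropagators, (3.35) p.396 («U with values in G»), bookkeeping] -/
theorem frustCfg_mem_of_neg_one_mem {G : Subgroup 𝔸ˣ} (hG : (-1 : 𝔸ˣ) ∈ G) (μ : Fin (d + 1)) (x : Site (PV d ℓ i.m i.K hd hL) 0) :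
    frustCfg 𝔸 i μ x ∈ G := by
  rcases frustCfg_eq_one_or (𝔸 := 𝔸) i μ x with h | h
  · rw [h]; exact G.one_mem
  · rw [h]; exact hG

/-- `Re U(∂p) = −1`. [cite: Balaban1985BackgroundPropagators, (3.7) p.391] -/
theorem reHolY_frustCfg (p : PlaqY i) : reHolY i (frustCfg 𝔸 i) p = -1 := by
  rw [reHolY, val_holY_frustCfg, val_inv_holY_frustCfg, ← two_smul ℂ (-1 : 𝔸), smul_smul]
  norm_num

/-- `Im U(∂p) = 0`. [cite: Balaban1985BackgroundPropagators, (3.7) p.391] -/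
theorem imHolY_frustCfg (p : PlaqY i) : imHolY i (frustCfg 𝔸 i) p = 0 := by
  rw [imHolY, val_holY_frustCfg, val_inv_holY_frustCfg, sub_self, smul_zero]

/-- ★ the Jordan insertion of (3.10) is `−id` at the frustrated background: `𝒦_U F = ½(F·(−1) + (−1)·F) = −F`.
[cite: Balaban1985BackgroundPropagators, (3.7) p.391, (3.10) p.392] -/
theorem jordanY_frustCfg : jordanY i (frustCfg 𝔸 i) = -LinearMap.id := by
  refine LinearMap.ext fun F => funext fun p => ?_
  rw [jordanY_apply, reHolY_frustCfg, mul_neg_one, neg_one_mul, ← two_smul ℂ (-F p), smul_smul, LinearMap.neg_apply, LinearMap.id_apply,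
    Pi.neg_apply]
  norm_num

/-- ★ the commutator part `Δ′₂(U)` of (3.10) VANISHES at the frustrated background (`Im U(∂p) = 0` on every plaquette).
[cite: Balaban1985BackgroundPropagators, (3.10) p.392] -/
theorem curv2Y_frustCfg : curv2Y i (frustCfg 𝔸 i) = 0 := by
  refine LinearMap.ext fun A => funext fun b => ?_
  simp [curv2Y, imHolY_frustCfg, commY_zero]

/-- ★ **THE WILSON HESSIAN AT THE FRUSTRATED BACKGROUND IS `−D\*_U D_U`** (bond → plaquette sector): `Δ(U) = D\* ∘ 𝒦_U ∘ D + Δ′₂(U) = −(D\* ∘ D)`.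
[cite: Balaban1985BackgroundPropagators, (3.10) p.392] -/
theorem hessY_frustCfg : hessY i (frustCfg 𝔸 i) = -(coCurlY i (frustCfg 𝔸 i) ∘ₗ curlY i (frustCfg 𝔸 i)) := by
  rw [hessY, jordanY_frustCfg, curv2Y_frustCfg, add_zero, LinearMap.neg_comp, LinearMap.comp_neg, LinearMap.id_comp]

end Index

/-! ## §3 The Hessian's form is `≤ 0`; on `ker D\*_U ∩ ker Q(U)` it IS the form of `Δ_a(U)` -/

section Forms

open scoped Matrix.Norms.L2Operator

variable {d ℓ : ℕ} {hd : 1 ≤ d + 1} {hL : Odd (ℓ + 1) ∧ 1 < ℓ + 1} {b₀ b₁ : ℝ} {N : ℕ}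
variable (i : KIdx d ℓ hd hL b₀ b₁)

variable {S : Type} [Fintype S] in
/-- the trace pairing is odd in its second argument. [cite: Balaban1985BackgroundPropagators, p.393 (scalar products), bookkeeping] -/
theorem trIP_neg_right (w : S → ℝ) (Φ Ψ : S → Matrix (Fin N) (Fin N) ℂ) : trIP w Φ (-Ψ) = -trIP w Φ Ψ := by
  have h := trIP_add_right w Φ Ψ (-Ψ)
  rw [add_neg_cancel, trIP_zero_right] at h
  linarith

/-- the frustrated background is unitary-valued (`±1`). [cite: Balaban1985BackgroundPropagators, (3.35) p.396 («U with values in G»), bookkeeping] -/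
theorem frustCfg_mem_unitary (μ : Fin (d + 1)) (x : Site (PV d ℓ i.m i.K hd hL) 0) :
    ((frustCfg (Matrix (Fin N) (Fin N) ℂ) i μ x : (Matrix (Fin N) (Fin N) ℂ)ˣ) : Matrix (Fin N) (Fin N) ℂ) ∈ unitary (Matrix (Fin N) (Fin N) ℂ) := by
  rcases frustCfgV_val_eq_or (𝔸 := Matrix (Fin N) (Fin N) ℂ) (P := PV d ℓ i.m i.K hd hL) μ x with h | h
  · rw [frustCfg, h]; exact Submonoid.one_mem _
  · rw [frustCfg, h, Unitary.mem_iff, star_neg, star_one, neg_mul_neg, one_mul]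
    exact ⟨rfl, rfl⟩

/-- ★★ **THE WILSON HESSIAN IS NEGATIVE SEMI-DEFINITE AT THE FRUSTRATED BACKGROUND**: `⟨A, Δ(U)A⟩₁ = −⟨D_UA, D_UA⟩₁` for every bond function
`A` (by (3.9): the co-curl is the adjoint of the curl at a unitary-valued configuration). [cite: Balaban1985BackgroundPropagators, (3.9)–(3.10) p.392] -/
theorem trIP_hessY_frustCfg (A : FBondY i → Matrix (Fin N) (Fin N) ℂ) :
    trIP (fun _ => (1 : ℝ)) A (hessY i (frustCfg _ i) A)
      = -trIP (fun _ => (1 : ℝ)) (curlY i (frustCfg _ i) A) (curlY i (frustCfg _ i) A) := by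
  rw [hessY_frustCfg, LinearMap.neg_apply, trIP_neg_right, LinearMap.comp_apply,
    ← isAdjTr_curlY_coCurlY i (frustCfg _ i) (frustCfg_mem_unitary i) A]

/-- hence `⟨A, Δ(U)A⟩₁ ≤ 0`. [cite: Balaban1985BackgroundPropagators, (3.10) p.392] -/
theorem trIP_hessY_frustCfg_nonpos (A : FBondY i → Matrix (Fin N) (Fin N) ℂ) :
    trIP (fun _ => (1 : ℝ)) A (hessY i (frustCfg _ i) A) ≤ 0 := by
  rw [trIP_hessY_frustCfg, neg_nonpos]
  exact trIP_self_nonneg _ (fun _ => one_pos) _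

variable {𝔸 : Type} [NormedRing 𝔸] [NormedAlgebra ℂ 𝔸] [CompleteSpace 𝔸] in
/-- (3.26) on the joint kernel of `D\*_U` and `Q(U)`: there the gauge-fixing term `D_U R(U) D\*_U` and the averaging term `Q\*(U) a Q(U)` vanish and
`Δ_a(U)A = Δ(U)A` — for ANY transporter tables `parS`, `parB` and ANY site-propagator letter `Gp`. [cite: Balaban1985BackgroundPropagators, (3.26) p.395] -/
theorem deltaAY_apply_of_divY_QY_eq_zero (parS : SiteParY 𝔸 i) (parB : BondParY 𝔸 i) (Gp : SiteOpY 𝔸 i) (U : CfgY 𝔸 i) {A : FBondY i → 𝔸}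
    (hD : divY i U A = 0) (hQ : QY i parB U A = 0) : deltaAY i parS parB Gp U A = hessY i U A := by
  simp only [deltaAY, LinearMap.add_apply, LinearMap.comp_apply, hD, hQ, map_zero, add_zero]

/-- ★★ at the frustrated background, `⟨A, Δ_a(U)A⟩₁ ≤ 0` on `ker D\*_U ∩ ker Q(U)` — for every letter choice.
[cite: Balaban1985BackgroundPropagators, (3.26) p.395, (3.10) p.392] -/
theorem trIP_deltaAY_frustCfg_nonpos (parS : SiteParY (Matrix (Fin N) (Fin N) ℂ) i) (parB : BondParY (Matrix (Fin N) (Fin N) ℂ) i)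
    (Gp : SiteOpY (Matrix (Fin N) (Fin N) ℂ) i) {A : FBondY i → Matrix (Fin N) (Fin N) ℂ}
    (hD : divY i (frustCfg _ i) A = 0) (hQ : QY i parB (frustCfg _ i) A = 0) :
    trIP (fun _ => (1 : ℝ)) A (deltaAY i parS parB Gp (frustCfg _ i) A) ≤ 0 := by
  rw [deltaAY_apply_of_divY_QY_eq_zero i parS parB Gp _ hD hQ]
  exact trIP_hessY_frustCfg_nonpos i A

/-- ★★ **NO POSITIVE DEFINITENESS once the joint kernel is non-zero**: a non-zero `A` with `D\*_UA = 0`, `Q(U)A = 0` violates `PosDefTr 1 (Δ_a(U))` at the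
frustrated background. [cite: Balaban1985BackgroundPropagators, Thm 3.11 p.416 (the conclusion, here NEGATED outside (3.35)), (3.26) p.395] -/
theorem not_posDefTr_deltaAY_frustCfg_of (parS : SiteParY (Matrix (Fin N) (Fin N) ℂ) i) (parB : BondParY (Matrix (Fin N) (Fin N) ℂ) i)
    (Gp : SiteOpY (Matrix (Fin N) (Fin N) ℂ) i) {A : FBondY i → Matrix (Fin N) (Fin N) ℂ} (hA : A ≠ 0)
    (hD : divY i (frustCfg _ i) A = 0) (hQ : QY i parB (frustCfg _ i) A = 0) :
    ¬ PosDefTr (fun _ => (1 : ℝ)) (deltaAY i parS parB Gp (frustCfg _ i)) := fun h =>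
  absurd (h A hA) (not_lt.mpr (trIP_deltaAY_frustCfg_nonpos i parS parB Gp hD hQ))

end Forms

/-! ## §4 The census count `|sites| + |𝔅| < |bonds|` (no index bond at level 0) and rank–nullity -/

section Count

variable {d ℓ : ℕ} {hd : 1 ≤ d + 1} {hL : Odd (ℓ + 1) ∧ 1 < ℓ + 1} {b₀ b₁ : ℝ}
variable (i : KIdx d ℓ hd hL b₀ b₁)

/-- `|T^{(j)}|·(L^{d})^j = |T^{(0)}|` in the standing range (`TorusGeometry.Site.card_site_eq_mul_succ` iterated). [cite: Balaban1987RG1, (0.3) p.252, bookkeeping] -/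
theorem card_site_mul_pow (P : Params) {j : ℕ} (hj : j ≤ P.m + P.K) :
    Fintype.card (Site P j) * (P.L ^ P.d) ^ j = Fintype.card (Site P 0) := by
  induction j with
  | zero => simp
  | succ j ih =>
    rw [← ih (by omega), Site.card_site_eq_mul_succ hj, pow_succ]
    ring

/-- the fine bonds at an index: `|bonds| = (d+1)·|T_η|` (bonds = sites × directions, `T4PlaqDisjointFamilies.card_pbond`).
[cite: Balaban1985BackgroundPropagators, (3.1) p.390, bookkeeping] -/
theorem card_FBondY : Fintype.card (FBondY i) = (d + 1) * Fintype.card (Site (PV d ℓ i.m i.K hd hL) 0) := by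
  rw [show Fintype.card (FBondY i) = Fintype.card (PBond (PV d ℓ i.m i.K hd hL) 0) from rfl, T4PlaqDisjointFamilies.card_pbond, mul_comm]

/-- the fine sites at an index (NODE 00's box chart of the torus): `|sites| = |T_η|`. [cite: Balaban1985BackgroundPropagators, p.389 (T_η), bookkeeping] -/
theorem card_SiteY : Fintype.card (SiteY i) = Fintype.card (Site (PV d ℓ i.m i.K hd hL) 0) :=
  (Fintype.card_congr (boxEquiv i.hN)).symm

/-- ★ **NO INDEX BOND AT LEVEL 0**: p21's torus families have `lev ≥ 1` everywhere (`TDomains.one_le_lev`), so `Ω₁ = T_η` in the dictionary `domT`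
and the level-0 shell `Λ₀ = st(Ω₀) ∖ st(Ω₁)` of [4] (2.3) is EMPTY. [cite: Balaban1984PropagatorsII, (2.1)–(2.3) p.224] -/
theorem not_lamBond_zero (b : PBond (PV d ℓ i.m i.K hd hL) 0) : ¬ (domT i.hN i.D i.hk).LamBond 0 b := by
  have hdeep : ∀ y : Site (PV d ℓ i.m i.K hd hL) 0, (domT i.hN i.D i.hk).Deep 0 y := by
    intro y
    have hk1 : 1 ≤ i.k := le_trans one_le_two i.hk2
    show blockOf y ∈ (domT i.hN i.D i.hk).Om (0 + 1)
    simp only [domT, zero_add, one_ne_zero, if_false, hk1, if_true, Finset.mem_filter, Finset.mem_univ, true_and]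
    exact fun x _ => i.D.one_le_lev _
  exact fun h => h.2.1 (hdeep b.src)

/-- a subtype of a sigma type, read fibrewise. [cite: Balaban1984PropagatorsII, (2.3) p.224 (𝔅 = ⋃_j Λ_j), bookkeeping] -/
def sigmaSubtypeEquiv {ι : Type} (β : ι → Type) (Q : (Σ j, β j) → Prop) : {q : Σ j, β j // Q q} ≃ Σ j, {b : β j // Q ⟨j, b⟩} where
  toFun q := ⟨q.1.1, q.1.2, q.2⟩
  invFun q := ⟨⟨q.1, q.2.1⟩, q.2.2⟩
  left_inv _ := rfl
  right_inv _ := rfl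

open scoped Classical in
/-- `|𝔅| = Σ_{j=0}^{k} |Λ_j|` (the index bonds counted level by level). [cite: Balaban1984PropagatorsII, (2.3) p.224, bookkeeping] -/
theorem card_IBondY_eq_sum : Fintype.card (IBondY i)
    = ∑ j ∈ Finset.range (i.k + 1), Fintype.card {b : PBond (PV d ℓ i.m i.K hd hL) j // (domT i.hN i.D i.hk).LamBond j b} := by
  rw [show Fintype.card (IBondY i) = Fintype.card (Σ j : Fin (i.k + 1),
      {b : PBond (PV d ℓ i.m i.K hd hL) (j : ℕ) // (domT i.hN i.D i.hk).LamBond (j : ℕ) b}) from Fintype.card_congr (sigmaSubtypeEquiv _ _),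
    Fintype.card_sigma]
  exact Fin.sum_univ_eq_sum_range (fun j => Fintype.card {b : PBond (PV d ℓ i.m i.K hd hL) j // (domT i.hN i.D i.hk).LamBond j b}) (i.k + 1)

/-- `L^{d+1} ≥ 25` (`L = ℓ + 1 ≥ 5`, dimension `d + 1 ≥ 2`). [cite: Balaban1984PropagatorsII, (2.1) p.224, bookkeeping] -/
theorem twentyfive_le_pow (hℓ : 4 ≤ ℓ) (hd1 : 1 ≤ d) : (25 : ℝ) ≤ ((ℓ + 1 : ℕ) : ℝ) ^ (d + 1) := by
  have hL5 : (5 : ℝ) ≤ ((ℓ + 1 : ℕ) : ℝ) := by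
    have h : (4 : ℝ) ≤ ℓ := by exact_mod_cast hℓ
    push_cast; linarith
  calc (25 : ℝ) = 5 ^ 2 := by norm_num
    _ ≤ ((ℓ + 1 : ℕ) : ℝ) ^ 2 := by gcongr
    _ ≤ ((ℓ + 1 : ℕ) : ℝ) ^ (d + 1) := pow_le_pow_right₀ (by linarith) (by omega)

open scoped Classical in
/-- ★ **THE INDEX BONDS ARE SPARSE**: `|𝔅| ≤ (d+1)·|T_η|·Σ_{j≥1}(L^{d+1})^{−j} ≤ (d+1)·|T_η|/24` (every index bond is an `L^j`-bond with `j ≥ 1`,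
and `|bonds of T^{(j)}| = (d+1)|T_η|·L^{−(d+1)j}`). [cite: Balaban1984PropagatorsII, (2.3) p.224; Balaban1987RG1, (0.3) p.252] -/
theorem card_IBondY_le (hd1 : 1 ≤ d) :
    (Fintype.card (IBondY i) : ℝ) ≤ (d + 1) * Fintype.card (Site (PV d ℓ i.m i.K hd hL) 0) / 24 := by
  set P := PV d ℓ i.m i.K hd hL with hP
  set S : ℝ := (Fintype.card (Site P 0) : ℝ) with hS
  set q : ℝ := (((ℓ + 1 : ℕ) : ℝ) ^ (d + 1))⁻¹ with hq
  have h25 := twentyfive_le_pow i.hℓ hd1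
  have hq0 : 0 ≤ q := by rw [hq]; positivity
  have hq25 : q ≤ 1 / 25 := by
    rw [hq, one_div]
    exact inv_anti₀ (by norm_num) h25
  have hq1 : q < 1 := by linarith
  -- level by level
  have hlev : ∀ j, j + 1 ≤ i.k →
      (Fintype.card {b : PBond P (j + 1) // (domT i.hN i.D i.hk).LamBond (j + 1) b} : ℝ) ≤ (d + 1) * S * q ^ (j + 1) := by
    intro j hj
    have hjm : j + 1 ≤ P.m + P.K := le_trans hj i.hk
    have h1 : Fintype.card {b : PBond P (j + 1) // (domT i.hN i.D i.hk).LamBond (j + 1) b} ≤ Fintype.card (Site P (j + 1)) * (d + 1) := by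
      rw [← show P.d = d + 1 from rfl, ← T4PlaqDisjointFamilies.card_pbond]
      exact Fintype.card_subtype_le _
    have h2 : (Fintype.card (Site P (j + 1)) : ℝ) = S * q ^ (j + 1) := by
      have h := card_site_mul_pow P hjm
      have h' : (Fintype.card (Site P (j + 1)) : ℝ) * (((ℓ + 1 : ℕ) : ℝ) ^ (d + 1)) ^ (j + 1) = S := by
        rw [hS]; exact_mod_cast h
      rw [← h', hq, inv_pow, mul_assoc, mul_inv_cancel₀ (pow_ne_zero _ (by positivity)), mul_one]
    calc (Fintype.card {b : PBond P (j + 1) // (domT i.hN i.D i.hk).LamBond (j + 1) b} : ℝ)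
        ≤ (Fintype.card (Site P (j + 1)) : ℝ) * (d + 1) := by exact_mod_cast h1
      _ = (d + 1) * S * q ^ (j + 1) := by rw [h2]; ring
  have h0 : Fintype.card {b : PBond P 0 // (domT i.hN i.D i.hk).LamBond 0 b} = 0 :=
    Fintype.card_eq_zero_iff.mpr ⟨fun b => not_lamBond_zero i b.1 b.2⟩
  have hsum : (Fintype.card (IBondY i) : ℝ) ≤ (d + 1) * S * (q * ∑ j ∈ Finset.range i.k, q ^ j) := by
    rw [card_IBondY_eq_sum, Finset.sum_range_succ', h0, add_zero, Nat.cast_sum, Finset.mul_sum, Finset.mul_sum]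
    refine Finset.sum_le_sum fun j hj => ?_
    rw [Finset.mem_range] at hj
    calc (Fintype.card {b : PBond P (j + 1) // (domT i.hN i.D i.hk).LamBond (j + 1) b} : ℝ) ≤ (d + 1) * S * q ^ (j + 1) := hlev j hj
      _ = (d + 1) * S * (q * q ^ j) := by rw [pow_succ']
  have hgeom : ∑ j ∈ Finset.range i.k, q ^ j ≤ 1 / (1 - q) := by
    have h := geom_sum_Ico_le_of_lt_one (m := 0) (n := i.k) hq0 hq1
    rwa [pow_zero, ← Finset.range_eq_Ico] at h
  have hS0 : 0 ≤ S := by rw [hS]; positivity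
  have hd0 : (0 : ℝ) ≤ d + 1 := by positivity
  have hfrac : q * ∑ j ∈ Finset.range i.k, q ^ j ≤ 1 / 24 := by
    calc q * ∑ j ∈ Finset.range i.k, q ^ j ≤ q * (1 / (1 - q)) := by gcongr
      _ = q / (1 - q) := by rw [mul_one_div]
      _ ≤ 1 / 24 := by
        rw [div_le_div_iff₀ (by linarith) (by norm_num)]
        linarith
  calc (Fintype.card (IBondY i) : ℝ) ≤ (d + 1) * S * (q * ∑ j ∈ Finset.range i.k, q ^ j) := hsum
    _ ≤ (d + 1) * S * (1 / 24) := by gcongr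
    _ = (d + 1) * S / 24 := by ring

/-- ★★ **THE CENSUS COUNT**: `|sites| + |𝔅| < |bonds|` at every k-level index of dimension `d + 1 ≥ 2` — the constraint map `A ↦ (D\*_UA, Q(U)A)` of the
gauge-fixing and averaging terms of (3.26) has fewer equations than unknowns.
[cite: Balaban1985BackgroundPropagators, (3.26) p.395; Balaban1984PropagatorsII, (2.3) p.224] -/
theorem card_SiteY_add_card_IBondY_lt (hd1 : 1 ≤ d) : Fintype.card (SiteY i) + Fintype.card (IBondY i) < Fintype.card (FBondY i) := by
  have hI := card_IBondY_le i hd1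
  have hS0 : (0 : ℝ) < Fintype.card (Site (PV d ℓ i.m i.K hd hL) 0) := by exact_mod_cast Fintype.card_pos
  have hd' : (1 : ℝ) ≤ d := by exact_mod_cast hd1
  have h : (Fintype.card (SiteY i) : ℝ) + Fintype.card (IBondY i) < Fintype.card (FBondY i) := by
    rw [card_SiteY, card_FBondY, Nat.cast_mul, Nat.cast_add, Nat.cast_one]
    nlinarith
  exact_mod_cast h

end Count

/-! ## §5 The witness: `Δ_a(U)` is NOT positive definite at the frustrated background — every index, every letter choice -/

section Witness

open scoped Matrix.Norms.L2Operator

variable {d ℓ : ℕ} {hd : 1 ≤ d + 1} {hL : Odd (ℓ + 1) ∧ 1 < ℓ + 1} {b₀ b₁ : ℝ} {N : ℕ}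
variable (i : KIdx d ℓ hd hL b₀ b₁)

/-- `−1 ∈ SU(N)` for even `N` (`det(−1) = (−1)^N = 1`): the frustrated background is an `SU(N)`-valued configuration for even `N`, e.g. `SU(2)`.
[cite: Balaban1985Averaging, p.18 (G = SU(N)), bookkeeping] -/
theorem neg_one_mem_specialUnitaryUnits (hN : Even N) : (-1 : (Matrix (Fin N) (Fin N) ℂ)ˣ) ∈ B7Prop2SpecialUnitary.specialUnitaryUnits (Fin N) := by
  show ((-1 : (Matrix (Fin N) (Fin N) ℂ)ˣ) : Matrix (Fin N) (Fin N) ℂ) ∈ Matrix.specialUnitaryGroup (Fin N) ℂ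
  rw [Units.val_neg, Units.val_one, Matrix.mem_specialUnitaryGroup_iff]
  refine ⟨?_, ?_⟩
  · rw [Matrix.mem_unitaryGroup_iff', star_neg, star_one, neg_mul_neg, one_mul]
  · rw [Matrix.det_neg, Matrix.det_one, mul_one, Fintype.card_fin, hN.neg_one_pow]

/-- so for even `N` the frustrated background is `SU(N)`-valued. [cite: Balaban1985Averaging, p.18 (G = SU(N)), bookkeeping] -/
theorem frustCfg_mem_specialUnitaryUnits (hN : Even N) (μ : Fin (d + 1)) (x : Site (PV d ℓ i.m i.K hd hL) 0) :
    frustCfg (Matrix (Fin N) (Fin N) ℂ) i μ x ∈ B7Prop2SpecialUnitary.specialUnitaryUnits (Fin N) :=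
  frustCfg_mem_of_neg_one_mem i (neg_one_mem_specialUnitaryUnits hN) μ x

/-- ★ **RANK–NULLITY**: at every index of dimension `≥ 2` and every `N ≥ 1` there is a NON-ZERO bond function with `D\*_U A = 0` and `Q(U)A = 0` — for
any configuration `U` and any bond transporter table `parB`. [cite: Balaban1985BackgroundPropagators, (3.26) p.395, (3.8) p.392, (3.12) p.393] -/
theorem exists_ne_zero_divY_QY_eq_zero (hd1 : 1 ≤ d) (hN : 1 ≤ N) (parB : BondParY (Matrix (Fin N) (Fin N) ℂ) i)
    (U : CfgY (Matrix (Fin N) (Fin N) ℂ) i) :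
    ∃ A : FBondY i → Matrix (Fin N) (Fin N) ℂ, A ≠ 0 ∧ divY i U A = 0 ∧ QY i parB U A = 0 := by
  haveI : Nonempty (Fin N) := ⟨⟨0, hN⟩⟩
  have hr : 0 < Module.finrank ℂ (Matrix (Fin N) (Fin N) ℂ) := Module.finrank_pos
  have hlt : Module.finrank ℂ ((SiteY i → Matrix (Fin N) (Fin N) ℂ) × (IBondY i → Matrix (Fin N) (Fin N) ℂ))
      < Module.finrank ℂ (FBondY i → Matrix (Fin N) (Fin N) ℂ) := by
    rw [Module.finrank_prod, Module.finrank_pi_fintype, Module.finrank_pi_fintype, Module.finrank_pi_fintype, Finset.sum_const,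
      Finset.sum_const, Finset.sum_const, smul_eq_mul, smul_eq_mul, smul_eq_mul, Finset.card_univ, Finset.card_univ, Finset.card_univ,
      ← add_mul]
    exact Nat.mul_lt_mul_of_pos_right (card_SiteY_add_card_IBondY_lt i hd1) hr
  have hker := LinearMap.ker_ne_bot_of_finrank_lt (f := (divY i U).prod (QY i parB U)) hlt
  obtain ⟨A, hA, hA0⟩ := (Submodule.ne_bot_iff _).mp hker
  rw [LinearMap.mem_ker, LinearMap.prod_apply, Prod.mk_eq_zero] at hA
  exact ⟨A, hA0, hA.1, hA.2⟩

/-- ★★★ **`Δ_a(U)` IS NOT POSITIVE DEFINITE AT THE MAXIMALLY FRUSTRATED BACKGROUND** — at every k-level index of dimension `d + 1 ≥ 2`, every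
`N ≥ 1`, and for EVERY choice of the transport contours `parS`, `parB` and of the site-propagator letter `Gp` entering (3.25)–(3.26).
[cite: Balaban1985BackgroundPropagators, Thm 3.11 p.416 («the operators … Δ_a, G are positive definite» — under (3.35)), (3.26) p.395, (3.10) p.392] -/
theorem not_posDefTr_deltaAY_frustCfg (hd1 : 1 ≤ d) (hN : 1 ≤ N) (parS : SiteParY (Matrix (Fin N) (Fin N) ℂ) i)
    (parB : BondParY (Matrix (Fin N) (Fin N) ℂ) i) (Gp : SiteOpY (Matrix (Fin N) (Fin N) ℂ) i) :
    ¬ PosDefTr (fun _ => (1 : ℝ)) (deltaAY i parS parB Gp (frustCfg (Matrix (Fin N) (Fin N) ℂ) i)) := by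
  obtain ⟨A, hA, hD, hQ⟩ := exists_ne_zero_divY_QY_eq_zero i hd1 hN parB (frustCfg (Matrix (Fin N) (Fin N) ℂ) i)
  exact not_posDefTr_deltaAY_frustCfg_of i parS parB Gp hA hD hQ

/-- ★★★ **THE NEGATIVE SIDE OF ROW 17's DISPLAYED CLAUSE**: without the regularity class (3.35) the conclusion «Δ_a(U) positive definite» of Theorem 3.11
FAILS — at every index (dimension `≥ 2`, `N ≥ 1`) there is a unitary-valued background with `¬ PosDefTr 1 (Δ_a(U))`, whatever the letters `parS parB Gp`.
[cite: Balaban1985BackgroundPropagators, Thm 3.11 p.416, (3.35) p.396, (3.26) p.395] -/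
theorem exists_not_posDefTr_deltaAY (hd1 : 1 ≤ d) (hN : 1 ≤ N) (parS : SiteParY (Matrix (Fin N) (Fin N) ℂ) i)
    (parB : BondParY (Matrix (Fin N) (Fin N) ℂ) i) (Gp : SiteOpY (Matrix (Fin N) (Fin N) ℂ) i) :
    ∃ U : CfgY (Matrix (Fin N) (Fin N) ℂ) i, (∀ μ x, ((U μ x : (Matrix (Fin N) (Fin N) ℂ)ˣ) : Matrix (Fin N) (Fin N) ℂ) ∈ unitary (Matrix (Fin N) (Fin N) ℂ))
      ∧ ¬ PosDefTr (fun _ => (1 : ℝ)) (deltaAY i parS parB Gp U) :=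
  ⟨frustCfg (Matrix (Fin N) (Fin N) ℂ) i, frustCfg_mem_unitary i, not_posDefTr_deltaAY_frustCfg i hd1 hN parS parB Gp⟩

/-- ★★★ **AT def-Y's v4 LETTERS OF RECORD** (`parSymY`, `parBY`, `G′(U) = GpY parSymY`): the (3.35)-free version of the N06 knit's binder `hΔA` —
`∀ U, PosDefTr 1 (deltaAY i (parSymY i) (parBY i) (GpY i (parSymY i)) U)` — is FALSE at every index (dimension `≥ 2`, `N ≥ 1`): (3.35) is load-bearing.
[cite: Balaban1985BackgroundPropagators, Thm 3.11 p.416, (3.35) p.396] -/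
theorem not_forall_posDefTr_deltaAY_parSymY (hd1 : 1 ≤ d) (hN : 1 ≤ N) :
    ¬ ∀ U : CfgY (Matrix (Fin N) (Fin N) ℂ) i, PosDefTr (fun _ => (1 : ℝ)) (deltaAY i (parSymY i) (parBY i) (GpY i (parSymY i)) U) := fun h =>
  not_posDefTr_deltaAY_frustCfg i hd1 hN (parSymY i) (parBY i) (GpY i (parSymY i)) (h _)

/-- the same with the unitarity of the witness recorded. [cite: Balaban1985BackgroundPropagators, Thm 3.11 p.416, (3.35) p.396] -/
theorem exists_not_posDefTr_deltaAY_parSymY (hd1 : 1 ≤ d) (hN : 1 ≤ N) :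
    ∃ U : CfgY (Matrix (Fin N) (Fin N) ℂ) i, (∀ μ x, ((U μ x : (Matrix (Fin N) (Fin N) ℂ)ˣ) : Matrix (Fin N) (Fin N) ℂ) ∈ unitary (Matrix (Fin N) (Fin N) ℂ))
      ∧ ¬ PosDefTr (fun _ => (1 : ℝ)) (deltaAY i (parSymY i) (parBY i) (GpY i (parSymY i)) U) :=
  exists_not_posDefTr_deltaAY i hd1 hN _ _ _

end Witness

end

end Literature.MathematicalPhysics.QuantumFieldTheory.Balaban1983to89.B9Thm311DeltaAFrustratedWitness
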